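import Summits.RiemannHypothesis.RiemannHypothesis.Theorems.GapsEvoDoorsMTDefs

/-!
# GapsEvoDoors — the Montgomery–Taylor cosine majorant: closed-form integrals and the certificate

Companion of `GapsEvoDoorsMTDefs.lean` / `GapsEvoDoorsMTFourier.lean` (objects for item
stmt-RiemannHypothesis-23131, `MultCertificateRecord`). With `G = mtAuto`, `h = mtProfile`,
`Δ = 53/50`, `θ = 3π/100`:

* `mtAuto_zero`: `G(0) = 53/100 + cos θ/π`; `mtProfile_zero_sq`: `h(0)² = 8(1 + sin θ)/π²`;
* `integral_mul_mtAuto`: `∫₀¹ α G(α) dα = 3/(50π) + (2cos θ − 53/25)/π² + (8 + 4 sin θ − 4 cos θ)/π³`;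
* `integral_mtAuto_window`: `∫₁^Δ G = (2 + 2 sin θ − 2 cos θ)/π² − 3/(50π)`;
* `mtAuto_nonneg_of_mem_window`: `G ≥ 0` on `[1, Δ]` (`cos(πα/2) ≥ −(π/2)(α − 1)`,
  `sin x ≥ (2/π)x`), so the two-sided window term of the certificate is `(1 + ε)∫₁^Δ G`;
* `certificate_le`: `G(0) + 2∫₀¹ αG + 2∫₁^Δ G ≤ (1293/1000)·h(0)²`, i.e.
  `m(g; 53/50, 0) = 1.29014 ≤ 1.293`, from `sin θ ≤ θ`, `θ − θ³/6 ≤ sin θ`,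
  `1 − θ²/2 ≤ cos θ ≤ 1 − θ²/2 + (5/96)θ⁴` and `3.141592 < π < 3.141593`.

All by the fundamental theorem of calculus and elementary bounds; nothing here bears on the truth
of RH.
-/

noncomputable section

open Real Set MeasureTheory

set_option linter.dupNamespace false  -- the mandated namespace repeats `RiemannHypothesis`

namespace Summit.RiemannHypothesis.RiemannHypothesis.Theorems.GapsEvoDoorsMT

/-! ### 1. Values of `G` -/

/-- `G` on `[0, Δ]`. -/
theorem mtAuto_of_mem {α : ℝ} (h0 : 0 ≤ α) (h1 : α ≤ 53 / 50) :
    mtAuto α = (53 / 50 - α) / 2 * Real.cos (π / 2 * α) + Real.sin (π / 2 * (53 / 50 - α)) / π := by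
  unfold mtAuto
  rw [abs_of_nonneg h0, if_pos h1]

/-- `G(0) = 53/100 + cos(3π/100)/π`. -/
theorem mtAuto_zero : mtAuto 0 = 53 / 100 + Real.cos (3 * π / 100) / π := by
  rw [mtAuto_of_mem le_rfl (by norm_num), mul_zero, Real.cos_zero, sub_zero,
    show π / 2 * (53 / 50 : ℝ) = 3 * π / 100 + π / 2 by ring, Real.sin_add_pi_div_two]
  ring

/-- `h(0)² = 8(1 + sin(3π/100))/π²` (`h(0) = 4 sin(53π/200)/π`, `2 sin² = 1 − cos`). -/
theorem mtProfile_zero_sq : mtProfile 0 ^ 2 = 8 * (1 + Real.sin (3 * π / 100)) / π ^ 2 := by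
  have hπ : π ≠ 0 := Real.pi_ne_zero
  have hx : (π / 2 - 2 * π * 0) * (53 / 100 : ℝ) = 53 * π / 200 := by ring
  have hx' : (π / 2 + 2 * π * 0) * (53 / 100 : ℝ) = 53 * π / 200 := by ring
  have hne : (53 * π / 200 : ℝ) ≠ 0 := by positivity
  unfold mtProfile
  rw [hx, hx', Real.sinc_of_ne_zero hne]
  have hs : Real.sin (53 * π / 200) ^ 2 = (1 + Real.sin (3 * π / 100)) / 2 := by
    rw [Real.sin_sq_eq_half_sub, show 2 * (53 * π / 200 : ℝ) = 3 * π / 100 + π / 2 by ring,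
      Real.cos_add_pi_div_two]
    ring
  have e : 53 / 100 * (Real.sin (53 * π / 200) / (53 * π / 200) + Real.sin (53 * π / 200) / (53 * π / 200)) =
      4 * Real.sin (53 * π / 200) / π := by
    field_simp
    ring
  rw [e, div_pow, mul_pow, hs]
  ring

/-! ### 2. Derivatives of the building blocks -/

/-- `(sin(πy/2))' = (π/2) cos(πy/2)`. -/
theorem hasDerivAt_sin_half_pi (x : ℝ) :
    HasDerivAt (fun y : ℝ ↦ Real.sin (π / 2 * y)) (π / 2 * Real.cos (π / 2 * x)) x := by
  have h := ((hasDerivAt_id' x).const_mul (π / 2)).sin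
  simp only [mul_one] at h
  convert h using 1
  ring

/-- `(cos(πy/2))' = −(π/2) sin(πy/2)`. -/
theorem hasDerivAt_cos_half_pi (x : ℝ) :
    HasDerivAt (fun y : ℝ ↦ Real.cos (π / 2 * y)) (-(π / 2) * Real.sin (π / 2 * x)) x := by
  have h := ((hasDerivAt_id' x).const_mul (π / 2)).cos
  simp only [mul_one] at h
  convert h using 1
  ring

/-- `(sin(π(Δ − y)/2))' = −(π/2) cos(π(Δ − y)/2)`. -/
theorem hasDerivAt_sin_half_pi_sub (x : ℝ) :
    HasDerivAt (fun y : ℝ ↦ Real.sin (π / 2 * (53 / 50 - y)))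
      (-(π / 2) * Real.cos (π / 2 * (53 / 50 - x))) x := by
  have h := (((hasDerivAt_id' x).const_sub (53 / 50)).const_mul (π / 2)).sin
  convert h using 1
  ring

/-- `(cos(π(Δ − y)/2))' = (π/2) sin(π(Δ − y)/2)`. -/
theorem hasDerivAt_cos_half_pi_sub (x : ℝ) :
    HasDerivAt (fun y : ℝ ↦ Real.cos (π / 2 * (53 / 50 - y)))
      (π / 2 * Real.sin (π / 2 * (53 / 50 - x))) x := by
  have h := (((hasDerivAt_id' x).const_sub (53 / 50)).const_mul (π / 2)).cos
  convert h using 1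
  ring

/-! ### 3. The two integrals -/

/-- `∫₁^Δ G(α) dα = (2 + 2 sin θ − 2 cos θ)/π² − 3/(50π)`, `θ = 3π/100` (antiderivative
`(Δ/π) sin(πα/2) − α sin(πα/2)/π − 2cos(πα/2)/π² + 2cos(π(Δ − α)/2)/π²`). -/
theorem integral_mtAuto_window :
    ∫ α in (1 : ℝ)..(53 / 50), mtAuto α =
      (2 + 2 * Real.sin (3 * π / 100) - 2 * Real.cos (3 * π / 100)) / π ^ 2 - 3 / (50 * π) := by
  have hπ : π ≠ 0 := Real.pi_ne_zero
  have hcongr : ∫ α in (1 : ℝ)..(53 / 50), mtAuto α = ∫ α in (1 : ℝ)..(53 / 50),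
      ((53 / 50 - α) / 2 * Real.cos (π / 2 * α) + Real.sin (π / 2 * (53 / 50 - α)) / π) := by
    refine intervalIntegral.integral_congr fun α hα ↦ ?_
    rw [Set.uIcc_of_le (by norm_num), Set.mem_Icc] at hα
    exact mtAuto_of_mem (by linarith [hα.1]) hα.2
  rw [hcongr]
  have hderiv : ∀ x ∈ Set.uIcc (1 : ℝ) (53 / 50),
      HasDerivAt (fun α : ℝ ↦ 53 / 50 / π * Real.sin (π / 2 * α) - α * Real.sin (π / 2 * α) / π -
          2 / π ^ 2 * Real.cos (π / 2 * α) + 2 / π ^ 2 * Real.cos (π / 2 * (53 / 50 - α)))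
        ((53 / 50 - x) / 2 * Real.cos (π / 2 * x) + Real.sin (π / 2 * (53 / 50 - x)) / π) x := by
    intro x _
    have h1 := hasDerivAt_sin_half_pi x
    have h2 := (hasDerivAt_id' x).fun_mul (hasDerivAt_sin_half_pi x)
    have h3 := hasDerivAt_cos_half_pi x
    have h4 := hasDerivAt_cos_half_pi_sub x
    have h := (((h1.const_mul (53 / 50 / π)).fun_sub (h2.div_const π)).fun_sub
      (h3.const_mul (2 / π ^ 2))).fun_add (h4.const_mul (2 / π ^ 2))
    refine h.congr_deriv ?_
    field_simp
    ring
  rw [intervalIntegral.integral_eq_sub_of_hasDerivAt hderiv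
    ((by fun_prop : Continuous fun x : ℝ ↦ (53 / 50 - x) / 2 * Real.cos (π / 2 * x) +
      Real.sin (π / 2 * (53 / 50 - x)) / π).intervalIntegrable _ _)]
  have e1 : Real.sin (π / 2 * (53 / 50 : ℝ)) = Real.cos (3 * π / 100) := by
    rw [show π / 2 * (53 / 50 : ℝ) = 3 * π / 100 + π / 2 by ring, Real.sin_add_pi_div_two]
  have e2 : Real.cos (π / 2 * (53 / 50 : ℝ)) = -Real.sin (3 * π / 100) := by
    rw [show π / 2 * (53 / 50 : ℝ) = 3 * π / 100 + π / 2 by ring, Real.cos_add_pi_div_two]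
  have e3 : Real.cos (π / 2 * (53 / 50 - 53 / 50 : ℝ)) = 1 := by simp
  have e4 : Real.sin (π / 2 * (1 : ℝ)) = 1 := by rw [mul_one, Real.sin_pi_div_two]
  have e5 : Real.cos (π / 2 * (1 : ℝ)) = 0 := by rw [mul_one, Real.cos_pi_div_two]
  have e6 : Real.cos (π / 2 * (53 / 50 - 1 : ℝ)) = Real.cos (3 * π / 100) := by
    congr 1; ring
  simp only [e1, e2, e3, e4, e5, e6]
  field_simp
  ring

/-- `∫₀¹ α G(α) dα = 3/(50π) + (2cos θ − 53/25)/π² + (8 + 4 sin θ − 4 cos θ)/π³`, `θ = 3π/100`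
(antiderivative `(Δ/π)α sin(πα/2) + (2Δ/π²)cos(πα/2) − α² sin(πα/2)/π − (4/π²)α cos(πα/2) +
(8/π³) sin(πα/2) + (2/π²) α cos(π(Δ − α)/2) + (4/π³) sin(π(Δ − α)/2)`). -/
theorem integral_mul_mtAuto :
    ∫ α in (0 : ℝ)..1, α * mtAuto α =
      3 / (50 * π) + (2 * Real.cos (3 * π / 100) - 53 / 25) / π ^ 2 +
        (8 + 4 * Real.sin (3 * π / 100) - 4 * Real.cos (3 * π / 100)) / π ^ 3 := by
  have hπ : π ≠ 0 := Real.pi_ne_zero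
  have hcongr : ∫ α in (0 : ℝ)..1, α * mtAuto α = ∫ α in (0 : ℝ)..1,
      α * ((53 / 50 - α) / 2 * Real.cos (π / 2 * α) + Real.sin (π / 2 * (53 / 50 - α)) / π) := by
    refine intervalIntegral.integral_congr fun α hα ↦ ?_
    rw [Set.uIcc_of_le zero_le_one, Set.mem_Icc] at hα
    simp only [mtAuto_of_mem hα.1 (by linarith [hα.2])]
  rw [hcongr]
  have hderiv : ∀ x ∈ Set.uIcc (0 : ℝ) 1,
      HasDerivAt (fun α : ℝ ↦ 53 / 50 / π * (α * Real.sin (π / 2 * α)) +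
          2 * (53 / 50) / π ^ 2 * Real.cos (π / 2 * α) - α ^ 2 * Real.sin (π / 2 * α) / π -
          4 / π ^ 2 * (α * Real.cos (π / 2 * α)) + 8 / π ^ 3 * Real.sin (π / 2 * α) +
          2 / π ^ 2 * (α * Real.cos (π / 2 * (53 / 50 - α))) + 4 / π ^ 3 * Real.sin (π / 2 * (53 / 50 - α)))
        (x * ((53 / 50 - x) / 2 * Real.cos (π / 2 * x) + Real.sin (π / 2 * (53 / 50 - x)) / π)) x := by
    intro x _
    have hs := hasDerivAt_sin_half_pi x
    have hc := hasDerivAt_cos_half_pi x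
    have hs' := hasDerivAt_sin_half_pi_sub x
    have hc' := hasDerivAt_cos_half_pi_sub x
    have h2 := (hasDerivAt_id' x).fun_mul hs
    have h3 := (hasDerivAt_pow 2 x).fun_mul hs
    have h4 := (hasDerivAt_id' x).fun_mul hc
    have h6 := (hasDerivAt_id' x).fun_mul hc'
    have h := ((((((h2.const_mul (53 / 50 / π)).fun_add (hc.const_mul (2 * (53 / 50) / π ^ 2))).fun_sub
      (h3.div_const π)).fun_sub (h4.const_mul (4 / π ^ 2))).fun_add (hs.const_mul (8 / π ^ 3))).fun_add
      (h6.const_mul (2 / π ^ 2))).fun_add (hs'.const_mul (4 / π ^ 3))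
    refine h.congr_deriv ?_
    push_cast
    field_simp
    ring
  rw [intervalIntegral.integral_eq_sub_of_hasDerivAt hderiv
    ((by fun_prop : Continuous fun x : ℝ ↦ x * ((53 / 50 - x) / 2 * Real.cos (π / 2 * x) +
      Real.sin (π / 2 * (53 / 50 - x)) / π)).intervalIntegrable _ _)]
  have e1 : Real.sin (π / 2 * (53 / 50 - 0 : ℝ)) = Real.cos (3 * π / 100) := by
    rw [sub_zero, show π / 2 * (53 / 50 : ℝ) = 3 * π / 100 + π / 2 by ring, Real.sin_add_pi_div_two]
  have e2 : Real.cos (π / 2 * (53 / 50 - 0 : ℝ)) = -Real.sin (3 * π / 100) := by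
    rw [sub_zero, show π / 2 * (53 / 50 : ℝ) = 3 * π / 100 + π / 2 by ring, Real.cos_add_pi_div_two]
  have e4 : Real.sin (π / 2 * (1 : ℝ)) = 1 := by rw [mul_one, Real.sin_pi_div_two]
  have e5 : Real.cos (π / 2 * (1 : ℝ)) = 0 := by rw [mul_one, Real.cos_pi_div_two]
  have e6 : Real.cos (π / 2 * (53 / 50 - 1 : ℝ)) = Real.cos (3 * π / 100) := by
    congr 1; ring
  have e7 : Real.sin (π / 2 * (53 / 50 - 1 : ℝ)) = Real.sin (3 * π / 100) := by
    congr 1; ring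
  have e8 : Real.sin (π / 2 * (0 : ℝ)) = 0 := by rw [mul_zero, Real.sin_zero]
  have e9 : Real.cos (π / 2 * (0 : ℝ)) = 1 := by rw [mul_zero, Real.cos_zero]
  simp only [e1, e2, e4, e5, e6, e7, e8, e9]
  field_simp
  ring

/-! ### 4. `G ≥ 0` on the window `[1, Δ]` -/

/-- On `1 ≤ α ≤ 53/50`, `G(α) ≥ 0`: with `t = 53/50 − α ∈ [0, 3/50]`,
`cos(πα/2) = −sin(π(α − 1)/2) ≥ −π(α − 1)/2 ≥ −3π/100` and `sin(πt/2) ≥ t`, so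
`G(α) ≥ t(1/π − 3π/200) ≥ 0`. -/
theorem mtAuto_nonneg_of_mem_window {α : ℝ} (h1 : 1 ≤ α) (h2 : α ≤ 53 / 50) : 0 ≤ mtAuto α := by
  rw [mtAuto_of_mem (by linarith) h2]
  have hπ := Real.pi_gt_three
  have hπ' := Real.pi_lt_four
  have ht0 : 0 ≤ 53 / 50 - α := by linarith
  -- `cos(πα/2) ≥ −π(α − 1)/2`
  have hcos : -(π / 2 * (α - 1)) ≤ Real.cos (π / 2 * α) := by
    have e : Real.cos (π / 2 * α) = -Real.sin (π / 2 * (α - 1)) := by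
      rw [show π / 2 * α = π / 2 * (α - 1) + π / 2 by ring, Real.cos_add_pi_div_two]
    rw [e, neg_le_neg_iff]
    exact Real.sin_le (by nlinarith)
  -- `sin(πt/2) ≥ t`
  have hsin : 53 / 50 - α ≤ Real.sin (π / 2 * (53 / 50 - α)) :=
    Real.le_sin_mul ht0 (by linarith)
  have h3 : -(π / 2 * (α - 1)) * ((53 / 50 - α) / 2) ≤ Real.cos (π / 2 * α) * ((53 / 50 - α) / 2) :=
    mul_le_mul_of_nonneg_right hcos (by linarith)
  have h4 : (53 / 50 - α) / π ≤ Real.sin (π / 2 * (53 / 50 - α)) / π :=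
    div_le_div_of_nonneg_right hsin Real.pi_pos.le
  have h5 : (53 / 50 - α) / 4 ≤ (53 / 50 - α) / π :=
    div_le_div_of_nonneg_left ht0 Real.pi_pos hπ'.le
  have h6 : 0 ≤ (53 / 50 - α) * (1 - π * (α - 1)) := mul_nonneg ht0 (by nlinarith)
  have h7 : -(π / 2 * (α - 1)) * ((53 / 50 - α) / 2) + (53 / 50 - α) / 4 =
      (53 / 50 - α) * (1 - π * (α - 1)) / 4 := by ring
  linarith [h3, h4, h5, h6, h7]

/-- Hence `∫₁^Δ G ≥ 0`. -/
theorem integral_mtAuto_window_nonneg : 0 ≤ ∫ α in (1 : ℝ)..(53 / 50), mtAuto α :=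
  intervalIntegral.integral_nonneg (by norm_num) fun α hα ↦ mtAuto_nonneg_of_mem_window hα.1 hα.2

/-! ### 5. The certified inequality `m(g; 53/50, 0) ≤ 1.293` -/

/-- **The certificate**: `G(0) + 2∫₀¹ αG + 2∫₁^Δ G ≤ (1293/1000) h(0)²`, i.e.
`m(g; 53/50, 0) = 1.29013… ≤ 1.293`. After clearing `π³` this is
`0.53π³ + π² cos θ − 6.344 π sin θ − 10.584π + 16 + 8 sin θ − 8 cos θ ≤ 0` (`θ = 3π/100`), which
follows from `sin θ ≤ θ`, `θ − θ³/6 ≤ sin θ`, `1 − θ²/2 ≤ cos θ ≤ 1 − θ²/2 + (5/96)θ⁴` and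
`3.141592 < π < 3.141593` (slack `≈ 0.077`). -/
theorem certificate_le :
    mtAuto 0 + 2 * (∫ α in (0 : ℝ)..1, α * mtAuto α) + 2 * (∫ α in (1 : ℝ)..(53 / 50), mtAuto α) ≤
      1293 / 1000 * mtProfile 0 ^ 2 := by
  rw [mtAuto_zero, integral_mul_mtAuto, integral_mtAuto_window, mtProfile_zero_sq]
  set θ : ℝ := 3 * π / 100 with hθ
  have hπ1 := Real.pi_gt_d6
  have hπ2 := Real.pi_lt_d6
  have hπ0 := Real.pi_pos
  have hθ0 : 0 ≤ θ := by rw [hθ]; positivity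
  have hθ1 : |θ| ≤ 1 := by rw [abs_of_nonneg hθ0, hθ]; linarith
  -- trigonometric enclosures
  have hS1 : Real.sin θ ≤ θ := Real.sin_le hθ0
  have hS2 : θ - θ ^ 3 / 6 ≤ Real.sin θ := Real.sin_ge_sub_cube hθ0
  have hC1 : 1 - θ ^ 2 / 2 ≤ Real.cos θ := Real.one_sub_sq_div_two_le_cos
  have hC2 : Real.cos θ ≤ 1 - θ ^ 2 / 2 + θ ^ 4 * (5 / 96) := by
    have h := Real.cos_bound hθ1
    rw [abs_of_nonneg hθ0] at h
    linarith [(abs_le.1 h).2]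
  -- products with powers of `π`
  have hSπ : (θ - θ ^ 3 / 6) * π ≤ Real.sin θ * π := mul_le_mul_of_nonneg_right hS2 hπ0.le
  have hCπ : Real.cos θ * π ^ 2 ≤ (1 - θ ^ 2 / 2 + θ ^ 4 * (5 / 96)) * π ^ 2 :=
    mul_le_mul_of_nonneg_right hC2 (by positivity)
  -- powers of `π`
  have h2l : (3.141592 : ℝ) ^ 2 < π ^ 2 := by gcongr
  have h2u : π ^ 2 < (3.141593 : ℝ) ^ 2 := by gcongr
  have h3l : (3.141592 : ℝ) ^ 3 < π ^ 3 := by gcongr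
  have h3u : π ^ 3 < (3.141593 : ℝ) ^ 3 := by gcongr
  have h4l : (3.141592 : ℝ) ^ 4 < π ^ 4 := by gcongr
  have h4u : π ^ 4 < (3.141593 : ℝ) ^ 4 := by gcongr
  have h5u : π ^ 5 < (3.141593 : ℝ) ^ 5 := by gcongr
  have h6u : π ^ 6 < (3.141593 : ℝ) ^ 6 := by gcongr
  have h7u : π ^ 7 < (3.141593 : ℝ) ^ 7 := by gcongr
  -- clear denominators: multiply the claim by `π³ > 0`
  rw [hθ] at hS1 hS2 hC1 hC2 hSπ hCπ
  have key : (53 / 100 + Real.cos (3 * π / 100) / π +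
      2 * (3 / (50 * π) + (2 * Real.cos (3 * π / 100) - 53 / 25) / π ^ 2 +
        (8 + 4 * Real.sin (3 * π / 100) - 4 * Real.cos (3 * π / 100)) / π ^ 3) +
      2 * ((2 + 2 * Real.sin (3 * π / 100) - 2 * Real.cos (3 * π / 100)) / π ^ 2 - 3 / (50 * π))) * π ^ 3 ≤
      (1293 / 1000 * (8 * (1 + Real.sin (3 * π / 100)) / π ^ 2)) * π ^ 3 := by
    have e1 : (53 / 100 + Real.cos (3 * π / 100) / π +
        2 * (3 / (50 * π) + (2 * Real.cos (3 * π / 100) - 53 / 25) / π ^ 2 +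
          (8 + 4 * Real.sin (3 * π / 100) - 4 * Real.cos (3 * π / 100)) / π ^ 3) +
        2 * ((2 + 2 * Real.sin (3 * π / 100) - 2 * Real.cos (3 * π / 100)) / π ^ 2 - 3 / (50 * π))) *
          π ^ 3 =
        53 / 100 * π ^ 3 + Real.cos (3 * π / 100) * π ^ 2 + (4 * Real.sin (3 * π / 100) - 6 / 25) * π +
          16 + 8 * Real.sin (3 * π / 100) - 8 * Real.cos (3 * π / 100) := by
      field_simp
      ring
    have e2 : (1293 / 1000 * (8 * (1 + Real.sin (3 * π / 100)) / π ^ 2)) * π ^ 3 =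
        1293 / 125 * π + 1293 / 125 * (Real.sin (3 * π / 100) * π) := by
      field_simp
      ring
    rw [e1, e2]
    norm_num at h2l h2u h3l h3u h4l h4u h5u h6u h7u ⊢
    nlinarith [hS1, hC1, hSπ, hCπ, h2l, h2u, h3l, h3u, h4l, h4u, h5u, h6u, h7u, hπ1, hπ2]
  exact le_of_mul_le_mul_right key (by positivity)

end Summit.RiemannHypothesis.RiemannHypothesis.Theorems.GapsEvoDoorsMT

end
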